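import Literature.NumberTheory.Sieve.HeathBrownMorozClassTypeI
import Literature.NumberTheory.Sieve.HeathBrownMorozClassPairCount
import Literature.NumberTheory.Sieve.HeathBrownMorozClassFLSequences
import Literature.NumberTheory.Sieve.HeathBrownCubicFLRemaindersA
import HarnessLib

/-!
# The level of distribution of the class sequence (Heath-Brown–Moroz 2004, Lemma 2.3 summed)

Pure-proof file in the residue-class ("coset") port of D. R. Heath-Brown, *Primes represented by
`x³ + 2y³`*, Acta Math. 186 (2001), to the class `x ≡ a, y ≡ b (mod d)` of Heath-Brown–Moroz,
Proc. LMS 88 (2004): the class analogue of `level_of_typeI_A` (`HeathBrownCubicFLRemaindersA`), the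
summed form of the Type-I input consumed by the Fundamental-Lemma comparison ([HB, §6 p. 35]; [HBM,
Lemma 3.1]).  For every admissible class `(a, b) mod d` there are `θ < 2` (`θ = 15/8`) and `C, X₀`
with
`∑_{R ∈ 𝒯r, N(R) ≤ X^{3/2}} |#𝒜_R(class) − [(d,N R)=1]·X_{𝒜_f}·ρ₂(R)/N(R)| ≤ C X^θ`
for `X ≥ X₀`, `exp(−(log X)^{1/3}) ≤ η ≤ 1`, where `X_{𝒜_f} = classSizeA X η d =
(6η²X²/π²)(ζ(2)/ζ_d(2))d⁻²`: the class Type-I estimate `class_typeI_A` (with `A = 1`) over the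
`≤ 4 log X` dyadic blocks covering `1 < N(R) ≤ X^{3/2}` gives `≪ X^{7/4}(log X)^{c+1}`, and the term
`R = 1` is the class coprime-pair count `exists_abs_classCountA_top_sub_le`.  The proof is that of
`level_of_typeI_A` word for word (`eventually_level_bound`, `dyadIdx`), with `X₀ ≥ 4(d+2)²`.
Content: **`class_level`**.  [cite: HeathBrownMoroz2004, Lemma 2.3 and Lemma 3.1]
[cite: HeathBrownActa2001, §6 p. 35]
Search: `lean search 'level_of_typeI_A'` — the `d = 1` version only.
-/

noncomputable section

open NumberField Finset Filter

open scoped Topology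

namespace Literature.NumberTheory.Sieve.CubicSieve

open LFunctions.CubeRootTwoField CubicPrimes

open scoped Classical in
/-- **The level of distribution of the class sequence** (class analogue of `level_of_typeI_A`):
for `d ≥ 1` and an admissible class `(a, b)` (`a, b < d`, `(a³ + 2b³, d) = 1`) there are `θ < 2`
(`θ = 15/8`) and `C, X₀` with
`∑_{R ∈ 𝒯r, N(R) ≤ X^{3/2}} |#𝒜_R(class) − [(d,N R)=1]·classSizeA·ρ₂(R)/N(R)| ≤ C X^θ`
for `X ≥ X₀`, `exp(−(log X)^{1/3}) ≤ η ≤ 1`: `class_typeI_A` (A = 1) on the dyadic blocks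
`(2^j, 2^{j+1}]`, `j < 4 log X`, plus the term `R = 1` (`exists_abs_classCountA_top_sub_le`).
[cite: HeathBrownMoroz2004, Lemma 2.3] [cite: HeathBrownActa2001, §6 p. 35] -/
theorem class_level {d a b : ℕ} (hd : 0 < d) (ha : a < d) (hb : b < d)
    (hadm : Nat.Coprime (a ^ 3 + 2 * b ^ 3) d) :
    ∃ θ : ℝ, θ < 2 ∧ ∃ C X₀ : ℝ, ∀ X η : ℝ, X₀ ≤ X → Real.exp (-Real.log X ^ (1 / 3 : ℝ)) ≤ η →
      η ≤ 1 →
      ∑ R ∈ (idealsLE ⌊X ^ (3 / 2 : ℝ)⌋₊).filter (fun R => Squarefree (Ideal.absNorm R)),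
        |(classCountA X η d a b R : ℝ) -
          (if Nat.Coprime d (Ideal.absNorm R) then
            classSizeA X η d * rho₂ R / Ideal.absNorm R else 0)| ≤ C * X ^ θ := by
  obtain ⟨c, C, -, -, hC⟩ := class_typeI_A 1 one_pos
  obtain ⟨C₁, hC₁0, hC₁⟩ := exists_abs_classCountA_top_sub_le (a := a) (b := b) hd hadm
  set c' : ℝ := max c 0 with hc'
  set C' : ℝ := max C 0 with hC'
  have hc'0 : 0 ≤ c' := le_max_right _ _
  have hC'0 : 0 ≤ C' := le_max_right _ _
  obtain ⟨X₁, hX₁⟩ := Filter.eventually_atTop.mp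
    (eventually_level_bound (c := c') hC₁0.le (by positivity : (0 : ℝ) ≤ 12 * C'))
  refine ⟨15 / 8, by norm_num, 1, max X₁ (max 3 (4 * ((d : ℝ) + 2) ^ 2)),
    fun X η hX hηlo hη1 => ?_⟩
  have hX3 : 3 ≤ X := le_trans (le_max_left _ _) (le_trans (le_max_right _ _) hX)
  have hXd : 4 * ((d : ℝ) + 2) ^ 2 ≤ X :=
    le_trans (le_max_right _ _) (le_trans (le_max_right _ _) hX)
  have hXX₁ : X₁ ≤ X := le_trans (le_max_left _ _) hX
  have hX0 : 0 < X := by linarith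
  have hX1 : 1 ≤ X := by linarith
  have hη0' : 0 < η := (Real.exp_pos _).trans_le hηlo
  have hη0 : 0 ≤ η := hη0'.le
  have hlog1 : 1 ≤ Real.log X := by
    rw [← Real.log_exp 1]
    exact Real.log_le_log (Real.exp_pos 1) (by linarith [Real.exp_one_lt_d9])
  have hlog0 : 0 < Real.log X := by linarith
  -- the summand
  set f : Ideal (𝓞 K) → ℝ := fun R => |(classCountA X η d a b R : ℝ) -
    (if Nat.Coprime d (Ideal.absNorm R) then classSizeA X η d * rho₂ R / Ideal.absNorm R else 0)|
    with hf
  have hf0 : ∀ R, 0 ≤ f R := fun R => abs_nonneg _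
  -- the dyadic blocks with `Q = 2^j`
  set B : ℕ → Finset (Ideal (𝓞 K)) := fun j =>
    (idealsLE ⌊2 * (2 : ℝ) ^ j⌋₊).filter fun R => (2 : ℝ) ^ j < (Ideal.absNorm R : ℝ) ∧
      (Ideal.absNorm R : ℝ) ≤ 2 * (2 : ℝ) ^ j ∧ Squarefree (Ideal.absNorm R) with hB
  set n : ℕ := ⌊X ^ (3 / 2 : ℝ)⌋₊ with hn
  set J : ℕ := Nat.log 2 n + 1 with hJ
  have hn1 : 1 ≤ n := Nat.le_floor (by rw [Nat.cast_one]; exact Real.one_le_rpow hX1 (by norm_num))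
  have hnX : (n : ℝ) ≤ X ^ (3 / 2 : ℝ) := Nat.floor_le (Real.rpow_nonneg hX0.le _)
  -- the cover
  have hcover : (idealsLE n).filter (fun R => Squarefree (Ideal.absNorm R)) ⊆
      {⊤} ∪ (range J).biUnion B := by
    intro R hR
    rw [mem_filter, mem_idealsLE] at hR
    obtain ⟨hRn, hRsq⟩ := hR
    rw [mem_union, mem_singleton, mem_biUnion]
    by_cases h1 : Ideal.absNorm R = 1
    · exact Or.inl (Ideal.absNorm_eq_one_iff.mp h1)
    · right
      have hN0 : Ideal.absNorm R ≠ 0 := hRsq.ne_zero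
      have hN2 : 2 ≤ Ideal.absNorm R := by omega
      refine ⟨dyadIdx (Ideal.absNorm R), ?_, ?_⟩
      · rw [mem_range, hJ, Nat.lt_succ_iff, dyadIdx]
        exact Nat.log_mono_right (by omega)
      · have hlt := pow_dyadIdx_lt hN2
        have hle := le_pow_dyadIdx_succ (Ideal.absNorm R)
        have hlt' : (2 : ℝ) ^ dyadIdx (Ideal.absNorm R) < (Ideal.absNorm R : ℝ) := by
          exact_mod_cast hlt
        have hle' : (Ideal.absNorm R : ℝ) ≤ 2 * (2 : ℝ) ^ dyadIdx (Ideal.absNorm R) := by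
          rw [← pow_succ']; exact_mod_cast hle
        rw [hB, mem_filter, mem_idealsLE]
        exact ⟨Nat.le_floor hle', hlt', hle', hRsq⟩
  -- the block bounds from the class Type-I estimate
  have hblock : ∀ j ∈ range J,
      ∑ R ∈ B j, f R ≤ C' * (3 * X ^ (7 / 4 : ℝ)) * ((5 / 2) * Real.log X) ^ c' := by
    intro j hj
    have hQ1 : (1 : ℝ) ≤ (2 : ℝ) ^ j := one_le_pow₀ (by norm_num)
    have hj' : j ≤ Nat.log 2 n := by rw [mem_range, hJ, Nat.lt_succ_iff] at hj; exact hj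
    have h2j : (2 : ℝ) ^ j ≤ X ^ (3 / 2 : ℝ) := by
      have h1 : 2 ^ j ≤ 2 ^ Nat.log 2 n := Nat.pow_le_pow_right (by norm_num) hj'
      have h2 : 2 ^ Nat.log 2 n ≤ n := Nat.pow_log_le_self 2 (by omega)
      calc (2 : ℝ) ^ j = ((2 ^ j : ℕ) : ℝ) := by push_cast; ring
        _ ≤ n := by exact_mod_cast h1.trans h2
        _ ≤ X ^ (3 / 2 : ℝ) := hnX
    have hstep := hC d a b hd ha hb hadm X η ((2 : ℝ) ^ j) hXd hη0' hη1 hQ1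
    -- drop `τ(R) ≥ 1` and identify the block
    have hle1 : ∑ R ∈ B j, f R ≤ ∑ R ∈ B j, (idealDivisorCount R : ℝ) ^ (1 : ℕ) *
        |(classCountA X η d a b R : ℝ) -
          (if Nat.Coprime d (Ideal.absNorm R) then
            6 * η ^ 2 * X ^ 2 / Real.pi ^ 2 * zetaTwoCorrection d / (d : ℝ) ^ 2 * rho₂ R /
              Ideal.absNorm R else 0)| := by
      refine sum_le_sum fun R _ => ?_
      have hτ : (1 : ℝ) ≤ (idealDivisorCount R : ℝ) ^ (1 : ℕ) := by
        rw [pow_one]; exact_mod_cast one_le_idealDivisorCount'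
      have : f R = |(classCountA X η d a b R : ℝ) -
          (if Nat.Coprime d (Ideal.absNorm R) then
            6 * η ^ 2 * X ^ 2 / Real.pi ^ 2 * zetaTwoCorrection d / (d : ℝ) ^ 2 * rho₂ R /
              Ideal.absNorm R else 0)| := by
        simp only [hf, classSizeA]
      rw [this]
      exact le_mul_of_one_le_left (abs_nonneg _) hτ
    refine hle1.trans (hstep.trans ?_)
    -- `C (Q + X√Q + X^{3/2}) (log QX)^c ≤ C' · 3X^{7/4} ((5/2) log X)^{c'}`
    have hX74 : X ^ (3 / 2 : ℝ) ≤ X ^ (7 / 4 : ℝ) :=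
      Real.rpow_le_rpow_of_exponent_le hX1 (by norm_num)
    have hsqrt : Real.sqrt ((2 : ℝ) ^ j) ≤ X ^ (3 / 4 : ℝ) := by
      have hsq : X ^ (3 / 2 : ℝ) = (X ^ (3 / 4 : ℝ)) ^ 2 := by
        rw [← Real.rpow_natCast, ← Real.rpow_mul hX0.le]; norm_num
      calc Real.sqrt ((2 : ℝ) ^ j) ≤ Real.sqrt (X ^ (3 / 2 : ℝ)) := Real.sqrt_le_sqrt h2j
        _ = X ^ (3 / 4 : ℝ) := by rw [hsq, Real.sqrt_sq (Real.rpow_nonneg hX0.le _)]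
    have hmid : X * Real.sqrt ((2 : ℝ) ^ j) ≤ X ^ (7 / 4 : ℝ) := by
      calc X * Real.sqrt ((2 : ℝ) ^ j) ≤ X * X ^ (3 / 4 : ℝ) :=
            mul_le_mul_of_nonneg_left hsqrt hX0.le
        _ = X ^ (7 / 4 : ℝ) := by rw [← Real.rpow_one_add' hX0.le (by norm_num)]; norm_num
    have hsum3 : (2 : ℝ) ^ j + X * Real.sqrt ((2 : ℝ) ^ j) + X ^ (3 / 2 : ℝ) ≤
        3 * X ^ (7 / 4 : ℝ) := by
      linarith [h2j.trans hX74]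
    have hlogQX : Real.log X ≤ Real.log ((2 : ℝ) ^ j * X) ∧
        Real.log ((2 : ℝ) ^ j * X) ≤ (5 / 2) * Real.log X := by
      constructor
      · exact Real.log_le_log hX0 (le_mul_of_one_le_left hX0.le hQ1)
      · calc Real.log ((2 : ℝ) ^ j * X) ≤ Real.log (X ^ (3 / 2 : ℝ) * X) :=
              Real.log_le_log (by positivity) (mul_le_mul_of_nonneg_right h2j hX0.le)
          _ = (5 / 2) * Real.log X := by
              rw [Real.log_mul (by positivity) hX0.ne', Real.log_rpow hX0]; ring
    have hlogpow : Real.log ((2 : ℝ) ^ j * X) ^ c ≤ ((5 / 2) * Real.log X) ^ c' := by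
      have hb1 : 1 ≤ Real.log ((2 : ℝ) ^ j * X) := hlog1.trans hlogQX.1
      calc Real.log ((2 : ℝ) ^ j * X) ^ c ≤ Real.log ((2 : ℝ) ^ j * X) ^ c' :=
            Real.rpow_le_rpow_of_exponent_le hb1 (le_max_left _ _)
        _ ≤ ((5 / 2) * Real.log X) ^ c' := Real.rpow_le_rpow (by linarith) hlogQX.2 hc'0
    have hCC' : C ≤ C' := le_max_left _ _
    have hfac0 : 0 ≤ ((2 : ℝ) ^ j + X * Real.sqrt ((2 : ℝ) ^ j) + X ^ (3 / 2 : ℝ)) *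
        Real.log ((2 : ℝ) ^ j * X) ^ c := by
      have : 0 ≤ Real.log ((2 : ℝ) ^ j * X) ^ c := Real.rpow_nonneg (by linarith [hlogQX.1]) _
      positivity
    calc C * ((2 : ℝ) ^ j + X * Real.sqrt ((2 : ℝ) ^ j) + X ^ (3 / 2 : ℝ)) *
          Real.log ((2 : ℝ) ^ j * X) ^ c
        = C * (((2 : ℝ) ^ j + X * Real.sqrt ((2 : ℝ) ^ j) + X ^ (3 / 2 : ℝ)) *
            Real.log ((2 : ℝ) ^ j * X) ^ c) := by ring
      _ ≤ C' * (((2 : ℝ) ^ j + X * Real.sqrt ((2 : ℝ) ^ j) + X ^ (3 / 2 : ℝ)) *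
            Real.log ((2 : ℝ) ^ j * X) ^ c) := mul_le_mul_of_nonneg_right hCC' hfac0
      _ ≤ C' * ((3 * X ^ (7 / 4 : ℝ)) * ((5 / 2) * Real.log X) ^ c') := by
          refine mul_le_mul_of_nonneg_left ?_ hC'0
          exact mul_le_mul hsum3 hlogpow (Real.rpow_nonneg (by linarith [hlogQX.1]) _)
            (by positivity)
      _ = C' * (3 * X ^ (7 / 4 : ℝ)) * ((5 / 2) * Real.log X) ^ c' := by ring
  -- the number of blocks: `J ≤ 4 log X`
  have hJle : (J : ℝ) ≤ 4 * Real.log X := by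
    have h2 : 2 ^ Nat.log 2 n ≤ n := Nat.pow_log_le_self 2 (by omega)
    have h3 : (2 : ℝ) ^ Nat.log 2 n ≤ X ^ (3 / 2 : ℝ) := by
      calc (2 : ℝ) ^ Nat.log 2 n = ((2 ^ Nat.log 2 n : ℕ) : ℝ) := by push_cast; ring
        _ ≤ n := by exact_mod_cast h2
        _ ≤ X ^ (3 / 2 : ℝ) := hnX
    have h4 : (Nat.log 2 n : ℝ) * Real.log 2 ≤ (3 / 2) * Real.log X := by
      rw [← Real.log_pow, ← Real.log_rpow hX0]
      exact Real.log_le_log (by positivity) h3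
    have hlog2 : (1 / 2 : ℝ) < Real.log 2 := by linarith [Real.log_two_gt_d9]
    have h5 : (Nat.log 2 n : ℝ) ≤ 3 * Real.log X := by
      by_contra hcon
      push Not at hcon
      nlinarith
    rw [hJ]; push_cast; linarith
  -- assemble
  have htop : f ⊤ ≤ C₁ * X * (1 + Real.log X) := by
    have h := hC₁ X η (by linarith) hη0 hη1
    have h1 : Squarefree (Ideal.absNorm (⊤ : Ideal (𝓞 K))) := by
      rw [Ideal.absNorm_top]; exact squarefree_one
    have hcop1 : Nat.Coprime d (Ideal.absNorm (⊤ : Ideal (𝓞 K))) := by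
      rw [Ideal.absNorm_top]; exact Nat.coprime_one_right d
    have hrho : rho₂ (⊤ : Ideal (𝓞 K)) = 1 := by
      rw [rho₂_eq_of_squarefree h1, Ideal.absNorm_top, Nat.primeFactors_one, prod_empty]
    simp only [hf]
    rw [if_pos hcop1, hrho, Ideal.absNorm_top, Nat.cast_one, div_one, mul_one, classSizeA]
    exact h
  calc ∑ R ∈ (idealsLE n).filter (fun R => Squarefree (Ideal.absNorm R)), f R
      ≤ ∑ R ∈ {⊤} ∪ (range J).biUnion B, f R :=
        sum_le_sum_of_subset_of_nonneg hcover fun R _ _ => hf0 R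
    _ ≤ ∑ R ∈ ({⊤} : Finset (Ideal (𝓞 K))), f R + ∑ R ∈ (range J).biUnion B, f R :=
        sum_union_le_add _ _ hf0
    _ ≤ f ⊤ + ∑ j ∈ range J, ∑ R ∈ B j, f R := by
        rw [sum_singleton]
        linarith [sum_biUnion_le_sum_sum_of_nonneg (range J) B hf0]
    _ ≤ C₁ * X * (1 + Real.log X) +
          ∑ _j ∈ range J, C' * (3 * X ^ (7 / 4 : ℝ)) * ((5 / 2) * Real.log X) ^ c' :=
        add_le_add htop (sum_le_sum hblock)
    _ = C₁ * X * (1 + Real.log X) +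
          J * (C' * (3 * X ^ (7 / 4 : ℝ)) * ((5 / 2) * Real.log X) ^ c') := by
        rw [sum_const, card_range, nsmul_eq_mul]
    _ ≤ C₁ * X * (1 + Real.log X) +
          4 * Real.log X * (C' * (3 * X ^ (7 / 4 : ℝ)) * ((5 / 2) * Real.log X) ^ c') := by
        have : 0 ≤ C' * (3 * X ^ (7 / 4 : ℝ)) * ((5 / 2) * Real.log X) ^ c' := by
          have : 0 ≤ ((5 / 2) * Real.log X) ^ c' := Real.rpow_nonneg (by positivity) _
          positivity
        nlinarith
    _ = C₁ * X * (1 + Real.log X) +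
          12 * C' * Real.log X * X ^ (7 / 4 : ℝ) * ((5 / 2) * Real.log X) ^ c' := by ring
    _ ≤ X ^ (15 / 8 : ℝ) := hX₁ X hXX₁
    _ = 1 * X ^ (15 / 8 : ℝ) := (one_mul _).symm

end Literature.NumberTheory.Sieve.CubicSieve

end
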